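import Summits.ValiantsHypothesis.ValiantsHypothesis.Theorems.BarrierLeverDescentCertificateSufficesBlocks

/-!
# Route BarrierLever — the CHAIN-certificate reduction for UT-D (item 19316), part 1/3:
# the chain weight and the ONE-CYCLE LEMMA

Helper file (`--supports stmt-ValiantsHypothesis-19316`; cell valiant-natproofs, rung V4, 𝒟-side;
prover seat val-np-p1; statement and proof plan by planner p1-g9, memo `HOME/p1/UTD-memo-g9.md`
§3(p) «CHAIN CERTIFICATES — the repaired tailored-D scheme»). Closes NO item. Part 2/3
(`BarrierLeverChainCertificateSufficesBlocks.lean`) proves the block lemma, part 3/3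
(`BarrierLeverChainCertificateSuffices.lean`) the outer comparison and the reduction
«chain certificate for the layout `(u, w)` ⇒ tropical-determinant certificate for `(u, w)`»
(the conclusion of UT-D, item 19316 `TropicalDetCertificatesExist`, layout-wise).

**Setting.** As in the descent files (`…BarrierLever.Descent`, item 19573): row literals
`ρ_x a = rowL x a`, column literals `κ_y c = colL y c` for cube points `x, y : Finset (Fin h)`;
`M = x ∆ y` is the mismatch set of the block `(x, y)`. Given ONE valuation `e` of literal pairs
and a constant `B`, the CHAIN WEIGHT `cwt e B` on `Fin (h+h) × Fin (h+h)` is `0` on AGREEMENT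
pairs (same coordinate, same bit), `e` on FORWARD pairs (row coordinate `<` column coordinate),
and `B + e` on BACKWARD pairs and on mismatched diagonal pairs (LOOPS) (`cwt_lit`). Compared with
the descent weight `Descent.dwt` of item 19573 the only change is that forward pairs are CHARGED
(`e` instead of `0`): this separates the rows `p` and `p ∪ {m}` that the pure descent scheme
could not distinguish (its refutation `…DescentFail.descentCertificatesFail`, the antipodal star).
The cost of an inner assignment `τ : Perm (Fin h)` for the block `(x, y)` is
`ccost e B x y τ = Σ_a cwt e B (ρ_x a) (κ_y (τ a))`; the CHAIN VALUE `chainVal e x y c` of a chain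
of coordinates `c₀, …, c_{k+1}` is `e (ρ_x c_{k+1}) (κ_y c₀) + Σ_{i ≤ k} e (ρ_x c_i) (κ_y c_{i+1})`
(one backward closing pair, `k + 1` forward steps).

**Main results.**
* ONE-CYCLE LEMMA (`apply_le_of_unique_descent`, `eq_incCycle_of_unique_descent`): a permutation
  of `Fin h` with exactly one descent `s` (`τ s < s`, every other point fixed or ascending) IS the
  increasing cycle (`NearPrincipal.incCycle`) of its moved set `T = {c₀ < ⋯ < c_{k+1}}`:
  `τ c_i = c_{i+1}`, `τ c_{k+1} = c₀`. Proof: no moved point `m` jumps over a moved point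
  `t > m` — the moved points below `t` other than `τ s` have their preimages below `t`, so exactly
  one moved point below `t` is mapped to `≥ t`, and the preimage of `t` is that point.
* `ccost_incCycle`: the increasing cycle on a set `s ⊇ M` with `|s| ≥ 2` costs exactly `B +` the
  chain value of the sorted `s`.

WHAT THIS IS NOT: no statement about layouts (part 3); the supplier conjecture «every injective
layout has a chain certificate» (`ChainCertificatesExist`, planner p1-g9/g10) is NOT claimed — it
is UNDECIDED on antipodal double stars for `h ≥ 9` (kit j252682 / j252729); nothing on UT-D in
general, on TT / TNS / item 19717, on crux stmt-ValiantsHypothesis-14610, or on `VP` versus `VNP`.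
-/

-- layout Summits/ValiantsHypothesis/ValiantsHypothesis forces the duplicated namespace component
set_option linter.dupNamespace false

namespace Summit.ValiantsHypothesis.ValiantsHypothesis.Theorems.BarrierLever.ChainCert

open Finset
open Summit.ValiantsHypothesis.ValiantsHypothesis.Theorems.BarrierLever.NearPrincipal
open Summit.ValiantsHypothesis.ValiantsHypothesis.Theorems.BarrierLever.Descent

variable {h : ℕ}

/-! ## 1. The chain weight -/

/-- The CHAIN WEIGHT built from a valuation `e` of literal pairs and a constant `B`: `0` on
agreement pairs (same coordinate, same bit); `e x y` on forward pairs (row coordinate `<` column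
coordinate); `B + e x y` on backward pairs and on mismatched diagonal pairs (loops). -/
def cwt (e : Fin (h + h) → Fin (h + h) → ℕ) (B : ℕ) (x y : Fin (h + h)) : ℕ :=
  if (rowDec x).1 = (colDec y).1 ∧ (rowDec x).2 = (colDec y).2 then 0
  else if (rowDec x).1 < (colDec y).1 then e x y else B + e x y

/-- The chain weight on a (row literal, column literal) pair of coordinates `a`, `c`. -/
theorem cwt_lit (e : Fin (h + h) → Fin (h + h) → ℕ) (B : ℕ) (x y : Finset (Fin h)) (a c : Fin h) :
    cwt e B (rowL x a) (colL y c) =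
      if a = c ∧ (a ∈ x ↔ c ∈ y) then 0
      else if a < c then e (rowL x a) (colL y c) else B + e (rowL x a) (colL y c) := by
  unfold cwt
  rw [rowDec_rowL, colDec_colL]
  dsimp only
  by_cases H : a = c ∧ (a ∈ x ↔ c ∈ y)
  · rw [if_pos ⟨H.1, decide_eq_decide.mpr H.2⟩, if_pos H]
  · rw [if_neg (fun H' => H ⟨H'.1, decide_eq_decide.mp H'.2⟩), if_neg H]

/-- Forward pairs cost `e`. -/
theorem cwt_lit_fwd (e : Fin (h + h) → Fin (h + h) → ℕ) (B : ℕ) (x y : Finset (Fin h))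
    {a c : Fin h} (hac : a < c) : cwt e B (rowL x a) (colL y c) = e (rowL x a) (colL y c) := by
  rw [cwt_lit, if_neg, if_pos hac]
  rintro ⟨H, -⟩
  rw [H] at hac
  exact lt_irrefl _ hac

/-- Agreement pairs are free. -/
theorem cwt_lit_agree (e : Fin (h + h) → Fin (h + h) → ℕ) (B : ℕ) (x y : Finset (Fin h))
    {a : Fin h} (ha : (a ∈ x ↔ a ∈ y)) : cwt e B (rowL x a) (colL y a) = 0 := by
  rw [cwt_lit, if_pos ⟨rfl, ha⟩]

/-- Backward pairs cost `B + e`. -/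
theorem cwt_lit_bwd (e : Fin (h + h) → Fin (h + h) → ℕ) (B : ℕ) (x y : Finset (Fin h))
    {a c : Fin h} (hca : c < a) : cwt e B (rowL x a) (colL y c) = B + e (rowL x a) (colL y c) := by
  rw [cwt_lit, if_neg, if_neg (lt_asymm hca)]
  rintro ⟨H, -⟩
  rw [H] at hca
  exact lt_irrefl _ hca

/-- Mismatched diagonal pairs (loops) cost `B + e`. -/
theorem cwt_lit_loop (e : Fin (h + h) → Fin (h + h) → ℕ) (B : ℕ) (x y : Finset (Fin h))
    {a : Fin h} (ha : ¬ (a ∈ x ↔ a ∈ y)) :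
    cwt e B (rowL x a) (colL y a) = B + e (rowL x a) (colL y a) := by
  rw [cwt_lit, if_neg, if_neg (lt_irrefl a)]
  rintro ⟨-, H⟩
  exact ha H

/-- A descent (`c < a`) or a fixed mismatch pays at least `B`. -/
theorem le_cwt_lit_of_not_fwd (e : Fin (h + h) → Fin (h + h) → ℕ) (B : ℕ) (x y : Finset (Fin h))
    {a c : Fin h} (hpay : c < a ∨ (c = a ∧ (a ∈ x ↔ a ∉ y))) :
    B ≤ cwt e B (rowL x a) (colL y c) := by
  rcases hpay with hca | ⟨rfl, hmis⟩
  · rw [cwt_lit_bwd e B x y hca]; exact Nat.le_add_right _ _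
  · rw [cwt_lit_loop e B x y ((mismatch_iff x y c).mp hmis)]; exact Nat.le_add_right _ _

/-! ## 2. Block costs, chain values and chain sets -/

/-- The cost of the inner assignment `τ` for the block (row point `x`, column point `y`):
`Σ_a cwt e B (ρ_x a) (κ_y (τ a))`. -/
def ccost (e : Fin (h + h) → Fin (h + h) → ℕ) (B : ℕ) (x y : Finset (Fin h))
    (τ : Equiv.Perm (Fin h)) : ℕ :=
  ∑ a, cwt e B (rowL x a) (colL y (τ a))

/-- An identity block costs `0` at the identity assignment. -/
theorem ccost_one_self (e : Fin (h + h) → Fin (h + h) → ℕ) (B : ℕ) (x : Finset (Fin h)) :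
    ccost e B x x 1 = 0 :=
  Finset.sum_eq_zero (fun a _ => by
    rw [Equiv.Perm.coe_one, id]; exact cwt_lit_agree e B x x Iff.rfl)

/-- The CHAIN VALUE of a chain of coordinates `c₀, …, c_{k+1}` (intended strictly increasing) on
the block `(x, y)`: the backward closing pair `(ρ_x c_{k+1}, κ_y c₀)` plus the forward steps
`(ρ_x c_i, κ_y c_{i+1})`, `i ≤ k`. -/
def chainVal (e : Fin (h + h) → Fin (h + h) → ℕ) (x y : Finset (Fin h)) {k : ℕ}
    (c : Fin (k + 2) → Fin h) : ℕ :=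
  e (rowL x (c (Fin.last (k + 1)))) (colL y (c 0)) +
    ∑ i : Fin (k + 1), e (rowL x (c i.castSucc)) (colL y (c i.succ))

/-! ## 3. The one-cycle lemma -/

/-- If `s` is the only descent of `τ`, every moved coordinate is `≤ s`
(the largest moved coordinate is a descent). -/
theorem le_descent_of_ne (τ : Equiv.Perm (Fin h)) (s : Fin h)
    (huniq : ∀ m, τ m < m → m = s) (m : Fin h) (hm : τ m ≠ m) : m ≤ s := by
  set T := univ.filter (fun m => τ m ≠ m) with hT
  have hmemT : ∀ m, m ∈ T ↔ τ m ≠ m := fun m => by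
    rw [hT, mem_filter]; simp only [mem_univ, true_and]
  have hTne : T.Nonempty := ⟨m, (hmemT m).mpr hm⟩
  have hm1 : T.max' hTne ∈ T := max'_mem T hTne
  have hmoved : τ (T.max' hTne) ≠ T.max' hTne := (hmemT _).mp hm1
  have hm2 : τ (T.max' hTne) ∈ T := (hmemT _).mpr (fun heq => hmoved (τ.injective heq))
  have hm3 : τ (T.max' hTne) ≤ T.max' hTne := le_max' T _ hm2
  have hm4 : T.max' hTne = s := huniq _ (lt_of_le_of_ne hm3 hmoved)
  rw [← hm4]
  exact le_max' T m ((hmemT m).mpr hm)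

/-- If `s` is a descent of `τ` and the only one, every moved coordinate is `≥ τ s`
(the preimage of the smallest moved coordinate is a descent). -/
theorem apply_descent_le_of_ne (τ : Equiv.Perm (Fin h)) (s : Fin h) (hs : τ s < s)
    (huniq : ∀ m, τ m < m → m = s) (m : Fin h) (hm : τ m ≠ m) : τ s ≤ m := by
  set T := univ.filter (fun m => τ m ≠ m) with hT
  have hmemT : ∀ m, m ∈ T ↔ τ m ≠ m := fun m => by
    rw [hT, mem_filter]; simp only [mem_univ, true_and]
  have hTne : T.Nonempty := ⟨s, (hmemT s).mpr hs.ne⟩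
  have hm1 : T.min' hTne ∈ T := min'_mem T hTne
  have hmoved : τ (T.min' hTne) ≠ T.min' hTne := (hmemT _).mp hm1
  have hpre : τ (τ.symm (T.min' hTne)) = T.min' hTne := Equiv.apply_symm_apply _ _
  have hpre_ne : τ.symm (T.min' hTne) ≠ T.min' hTne := fun heq =>
    hmoved (by rw [heq] at hpre; exact hpre)
  have hpre_T : τ.symm (T.min' hTne) ∈ T := (hmemT _).mpr (by rw [hpre]; exact hpre_ne.symm)
  have hle1 : T.min' hTne ≤ τ.symm (T.min' hTne) := min'_le T _ hpre_T
  have hlt1 : τ (τ.symm (T.min' hTne)) < τ.symm (T.min' hTne) := by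
    rw [hpre]; exact lt_of_le_of_ne hle1 hpre_ne.symm
  have hs1 : τ.symm (T.min' hTne) = s := huniq _ hlt1
  have hτs : τ s = T.min' hTne := by rw [← hs1, hpre]
  rw [hτs]
  exact min'_le T m ((hmemT m).mpr hm)

/-- A moved point of a permutation has a moved image. -/
theorem apply_ne_of_ne (τ : Equiv.Perm (Fin h)) {m : Fin h} (hm : τ m ≠ m) : τ (τ m) ≠ τ m :=
  fun heq => hm (τ.injective heq)

/-- ONE-CYCLE LEMMA, pointwise form: if `s` is a descent of `τ` and the only one, no moved
coordinate jumps over another moved coordinate — for moved `m < t` with `t` moved, `τ m ≤ t`.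
(Counting: the moved points below `t` other than `τ s` have their preimages below `t`; so exactly
one moved point below `t` is mapped to `≥ t`, and the preimage of `t` is such a point.) -/
theorem apply_le_of_unique_descent (τ : Equiv.Perm (Fin h)) (s : Fin h) (hs : τ s < s)
    (huniq : ∀ m, τ m < m → m = s) (m t : Fin h) (hm : τ m ≠ m) (ht : τ t ≠ t) (hmt : m < t) :
    τ m ≤ t := by
  classical
  by_contra hcon
  rw [not_le] at hcon
  -- ascents off `s`
  have hasc : ∀ p, p ≠ s → τ p ≠ p → p < τ p := fun p hps hp => by
    rcases lt_trichotomy (τ p) p with hlt | heq | hgt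
    · exact absurd (huniq p hlt) hps
    · exact absurd heq hp
    · exact hgt
  have hts : t ≤ s := le_descent_of_ne τ s huniq t ht
  have hc₀m : τ s ≤ m := apply_descent_le_of_ne τ s hs huniq m hm
  -- the moved points below `t`
  set U := univ.filter (fun v => τ v ≠ v ∧ v < t) with hUdef
  have hmemU : ∀ v, v ∈ U ↔ τ v ≠ v ∧ v < t := fun v => by
    rw [hUdef, mem_filter]; simp only [mem_univ, true_and]
  have hsU : s ∉ U := fun hsU => not_lt.mpr hts ((hmemU s).mp hsU).2
  have hc₀U : τ s ∈ U := (hmemU _).mpr ⟨apply_ne_of_ne τ hs.ne, lt_of_le_of_lt hc₀m hmt⟩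
  have hmU : m ∈ U := (hmemU m).mpr ⟨hm, hmt⟩
  -- claim A: a point other than `s` whose image is in `U` is in `U`
  have hA : ∀ p, p ≠ s → τ p ∈ U → p ∈ U := by
    intro p hps hp
    obtain ⟨hp1, hp2⟩ := (hmemU _).mp hp
    have hpm : τ p ≠ p := fun heq => hp1 (by rw [heq]; exact heq)
    exact (hmemU p).mpr ⟨hpm, (hasc p hps hpm).trans hp2⟩
  -- the preimages of `U \ {τ s}` lie in `U`
  set I := (U.erase (τ s)).image τ.symm with hIdef
  have hIU : I ⊆ U := by
    intro v hv
    rw [hIdef, mem_image] at hv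
    obtain ⟨v', hv', rfl⟩ := hv
    rw [mem_erase] at hv'
    refine hA _ (fun heq => hv'.1 ?_) (by rw [Equiv.apply_symm_apply]; exact hv'.2)
    rw [← heq, Equiv.apply_symm_apply]
  have hIcard : I.card = U.card - 1 := by
    rw [hIdef, card_image_of_injective _ τ.symm.injective, card_erase_of_mem hc₀U]
  have hmemI : ∀ v ∈ U, v ∉ I → ¬ (τ v ∈ U ∧ τ v ≠ τ s) := by
    intro v _ hvI hτv
    apply hvI
    rw [hIdef, mem_image]
    exact ⟨τ v, mem_erase.mpr ⟨hτv.2, hτv.1⟩, Equiv.symm_apply_apply _ _⟩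
  -- `U \ I` has exactly one element …
  have hdiff : (U \ I).card = 1 := by
    rw [card_sdiff_of_subset hIU, hIcard]
    have := Finset.card_pos.mpr ⟨_, hc₀U⟩
    omega
  -- … the preimage `p₀` of `t` is one …
  set p₀ := τ.symm t with hp₀def
  have hτp₀ : τ p₀ = t := Equiv.apply_symm_apply _ _
  have hp₀s : p₀ ≠ s := fun heq => by
    have h1 : t = τ s := by rw [← hτp₀, heq]
    exact lt_irrefl t (lt_of_le_of_lt (h1 ▸ hc₀m) hmt)
  have hp₀m : τ p₀ ≠ p₀ := fun heq => by
    rw [hτp₀] at heq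
    rw [heq] at ht
    exact ht (hτp₀.trans heq)
  have hp₀U : p₀ ∈ U := (hmemU _).mpr ⟨hp₀m, by
    have := hasc p₀ hp₀s hp₀m; rwa [hτp₀] at this⟩
  have hp₀I : p₀ ∉ I := fun hI => by
    have hτU : τ p₀ ∈ U := by
      rw [hIdef, mem_image] at hI
      obtain ⟨v', hv', hv'eq⟩ := hI
      rw [← hv'eq, Equiv.apply_symm_apply]
      exact (mem_erase.mp hv').2
    rw [hτp₀] at hτU
    exact lt_irrefl t ((hmemU t).mp hτU).2
  -- … and so is `m` (its image jumps over `t`): contradiction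
  have hmI : m ∉ I := fun hI => by
    have hτU : τ m ∈ U := by
      rw [hIdef, mem_image] at hI
      obtain ⟨v', hv', hv'eq⟩ := hI
      rw [← hv'eq, Equiv.apply_symm_apply]
      exact (mem_erase.mp hv').2
    exact lt_asymm hcon ((hmemU _).mp hτU).2
  have hboth : m ∈ U \ I ∧ p₀ ∈ U \ I := ⟨mem_sdiff.mpr ⟨hmU, hmI⟩, mem_sdiff.mpr ⟨hp₀U, hp₀I⟩⟩
  have hmp : m = p₀ := Finset.card_le_one.mp hdiff.le _ hboth.1 _ hboth.2
  have : τ m = t := by rw [hmp, hτp₀]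
  rw [this] at hcon
  exact lt_irrefl t hcon

/-- ONE-CYCLE LEMMA: a permutation of `Fin h` with exactly one descent `s` is the increasing
cycle (`NearPrincipal.incCycle`) of its moved set. -/
theorem eq_incCycle_of_unique_descent (τ : Equiv.Perm (Fin h)) (s : Fin h) (hs : τ s < s)
    (huniq : ∀ m, τ m < m → m = s) (k : ℕ)
    (hk : (univ.filter (fun m => τ m ≠ m)).card = k + 1) :
    τ = incCycle (univ.filter (fun m => τ m ≠ m)) (k + 1) hk := by
  classical
  set T := univ.filter (fun m => τ m ≠ m) with hT
  have hmemT : ∀ m, m ∈ T ↔ τ m ≠ m := fun m => by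
    rw [hT, mem_filter]; simp only [mem_univ, true_and]
  set F := T.orderIsoOfFin hk with hF
  have hsT : s ∈ T := (hmemT s).mpr hs.ne
  have hc₀T : τ s ∈ T := (hmemT _).mpr (apply_ne_of_ne τ hs.ne)
  have hFlast : ((F (Fin.last k) : T) : Fin h) = s := by
    apply le_antisymm
    · exact le_descent_of_ne τ s huniq _ ((hmemT _).mp (Subtype.coe_prop _))
    · have h1 : F (F.symm ⟨s, hsT⟩) ≤ F (Fin.last k) := F.monotone (Fin.le_last _)
      rw [OrderIso.apply_symm_apply] at h1
      exact h1
  have hF0 : ((F 0 : T) : Fin h) = τ s := by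
    apply le_antisymm
    · have h1 : F 0 ≤ F (F.symm ⟨τ s, hc₀T⟩) := F.monotone (Fin.zero_le _)
      rw [OrderIso.apply_symm_apply] at h1
      exact h1
    · exact apply_descent_le_of_ne τ s hs huniq _ ((hmemT _).mp (Subtype.coe_prop _))
  ext m : 1
  by_cases hm : m ∈ T
  swap
  · rw [incCycle_of_not_mem T (k + 1) hk m hm]
    by_contra hne
    exact hm ((hmemT m).mpr hne)
  obtain ⟨i, rfl⟩ : ∃ i : Fin (k + 1), ((F i : T) : Fin h) = m :=
    ⟨F.symm ⟨m, hm⟩, by rw [OrderIso.apply_symm_apply]⟩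
  rw [hF, incCycle_apply_image T (k + 1) hk i, ← hF]
  by_cases hi : i = Fin.last k
  · rw [hi, hFlast, finRotate_last, hF0]
  -- `F i < F (i+1)`; the image of `F i` is a moved point `> F i` and `≤ F (i+1)`
  have hlt : ((F i : T) : Fin h) < ((F (finRotate (k + 1) i) : T) : Fin h) := by
    rw [Subtype.coe_lt_coe, OrderIso.lt_iff_lt, lt_finRotate_iff_ne_last]
    exact hi
  have hmi : τ ((F i : T) : Fin h) ≠ ((F i : T) : Fin h) := (hmemT _).mp (Subtype.coe_prop _)
  have his : ((F i : T) : Fin h) ≠ s := fun heq => by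
    rw [← hFlast, Subtype.coe_inj] at heq
    exact hi (F.injective heq)
  have hle : τ ((F i : T) : Fin h) ≤ ((F (finRotate (k + 1) i) : T) : Fin h) :=
    apply_le_of_unique_descent τ s hs huniq _ _ hmi ((hmemT _).mp (Subtype.coe_prop _)) hlt
  have hgt : ((F i : T) : Fin h) < τ ((F i : T) : Fin h) := by
    rcases lt_trichotomy (τ ((F i : T) : Fin h)) ((F i : T) : Fin h) with h1 | h1 | h1
    · exact absurd (huniq _ h1) his
    · exact absurd h1 hmi
    · exact h1
  obtain ⟨j, hj⟩ : ∃ j : Fin (k + 1), ((F j : T) : Fin h) = τ ((F i : T) : Fin h) :=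
    ⟨F.symm ⟨_, (hmemT _).mpr (apply_ne_of_ne τ hmi)⟩, by rw [OrderIso.apply_symm_apply]⟩
  rw [← hj] at hle hgt ⊢
  rw [Subtype.coe_lt_coe, OrderIso.lt_iff_lt] at hgt
  rw [Subtype.coe_le_coe, OrderIso.le_iff_le] at hle
  have hij : j = finRotate (k + 1) i := by
    apply Fin.ext
    have h1 : ((finRotate (k + 1) i : Fin (k + 1)) : ℕ) = i + 1 := coe_finRotate_of_ne_last hi
    have h2 : (i : ℕ) < j := hgt
    have h3 : (j : ℕ) ≤ (finRotate (k + 1) i : ℕ) := hle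
    omega
  rw [hij]

/-! ## 4. The cost of an increasing cycle -/

/-- THE CYCLE COST: on a set `s ⊇ M` with `|s| = k + 2 ≥ 2`, the increasing cycle costs exactly
`B +` the chain value of (the sorted) `s` — `k + 1` forward pairs, one backward closing pair, and
agreement pairs off `s`. -/
theorem ccost_incCycle (e : Fin (h + h) → Fin (h + h) → ℕ) (B : ℕ) (x y : Finset (Fin h))
    (s : Finset (Fin h)) (k : ℕ) (hk : s.card = k + 2)
    (hM : ∀ m : Fin h, (m ∈ x ↔ m ∉ y) → m ∈ s) :
    ccost e B x y (incCycle s (k + 2) hk) =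
      B + chainVal e x y (fun i => ((s.orderIsoOfFin hk i : s) : Fin h)) := by
  classical
  set F := s.orderIsoOfFin hk with hF
  set τ := incCycle s (k + 2) hk with hτ
  unfold ccost
  rw [← Finset.sum_add_sum_compl s]
  -- off `s`: agreement pairs at fixed points
  have hoff : ∑ m ∈ sᶜ, cwt e B (rowL x m) (colL y (τ m)) = 0 := by
    refine Finset.sum_eq_zero (fun m hm => ?_)
    rw [Finset.mem_compl] at hm
    have hτm : τ m = m := by rw [hτ]; exact incCycle_of_not_mem s (k + 2) hk m hm
    rw [hτm]
    refine cwt_lit_agree e B x y ?_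
    have hnm : ¬ (m ∈ x ↔ m ∉ y) := fun hmis => hm (hM m hmis)
    tauto
  rw [hoff, add_zero]
  -- on `s`: reindex along `F`
  rw [← Finset.sum_coe_sort s, ← Equiv.sum_comp F.toEquiv]
  have hstep : ∀ i : Fin (k + 2),
      cwt e B (rowL x ((F.toEquiv i : s) : Fin h)) (colL y (τ ((F.toEquiv i : s) : Fin h))) =
        if i = Fin.last (k + 1) then B + e (rowL x ((F (Fin.last (k + 1)) : s) : Fin h))
            (colL y ((F 0 : s) : Fin h))
        else e (rowL x ((F i : s) : Fin h)) (colL y ((F (finRotate (k + 2) i) : s) : Fin h)) := by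
    intro i
    have h1 : τ ((F i : s) : Fin h) = ((F (finRotate (k + 2) i) : s) : Fin h) := by
      rw [hτ, hF]; exact incCycle_apply_image s (k + 2) hk i
    change cwt e B (rowL x ((F i : s) : Fin h)) (colL y (τ ((F i : s) : Fin h))) = _
    rw [h1]
    by_cases hi : i = Fin.last (k + 1)
    · rw [if_pos hi, hi, finRotate_last]
      refine cwt_lit_bwd e B x y ?_
      rw [Subtype.coe_lt_coe, OrderIso.lt_iff_lt]
      exact Fin.last_pos'
    · rw [if_neg hi]
      have hlt : ((F i : s) : Fin h) < ((F (finRotate (k + 2) i) : s) : Fin h) := by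
        rw [Subtype.coe_lt_coe, OrderIso.lt_iff_lt, lt_finRotate_iff_ne_last]
        exact hi
      exact cwt_lit_fwd e B x y hlt
  rw [Finset.sum_congr rfl (fun i _ => hstep i), Fin.sum_univ_castSucc, if_pos rfl]
  have hcs : ∀ i : Fin (k + 1),
      (if Fin.castSucc i = Fin.last (k + 1) then
          B + e (rowL x ((F (Fin.last (k + 1)) : s) : Fin h)) (colL y ((F 0 : s) : Fin h))
        else e (rowL x ((F (Fin.castSucc i) : s) : Fin h))
          (colL y ((F (finRotate (k + 2) (Fin.castSucc i)) : s) : Fin h))) =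
        e (rowL x ((F (Fin.castSucc i) : s) : Fin h)) (colL y ((F i.succ : s) : Fin h)) := by
    intro i
    rw [if_neg (Fin.castSucc_lt_last i).ne]
    have h2 : finRotate (k + 2) (Fin.castSucc i) = i.succ := by
      apply Fin.ext
      rw [coe_finRotate_of_ne_last (Fin.castSucc_lt_last i).ne, Fin.val_castSucc, Fin.val_succ]
    rw [h2]
  rw [Finset.sum_congr rfl (fun i _ => hcs i)]
  unfold chainVal
  ring

end Summit.ValiantsHypothesis.ValiantsHypothesis.Theorems.BarrierLever.ChainCert
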